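import Mathlib
import Literature.Analysis.FluidPDE.SpaceTimeRescaling
import Literature.Analysis.FluidPDE.PressureDeterminedUpToTime
import Literature.Analysis.FluidPDE.SuitableWeakCongr
import Summits.NavierStokesRegularity.NavierStokesRegularity.Theorems.EulerZoomLiouvillePowerGaugeEulerLiouvilleSelfSimilarPressureSlavingTools
import HarnessLib

/-!
# Crux E `PowerGaugeEulerLiouville` (stmt-NavierStokesRegularity-19832): IN SEREGIN'S CLASS THE PRESSURE IS A FUNCTIONAL OF THE VELOCITY
# — uniqueness a.e., and inheritance of every slab-preserving Euler symmetry of the velocity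
# (lane «pressure slaving», the general principle behind `…SelfSimilarPressureSlaving` (continuous group) and ns-ezl-w1's `…DSSPressureSlaving`
# (discrete group); width seat ns-ezl-w3 g2)

Route `EulerZoomLiouville` (NavierStokesRegularity), crux E.  Two distributional Euler pressures of ONE velocity on the slab `(−∞,0) × ℝ³` differ by a function of
time a.e. (Rusin–Šverák; tree `ae_exists_const_of_forall_integral_mul_divergence_eq_zero` with `PressureSlaving.setIntegral_sub_mul_divergence_eq_zero`), and
the `D`-type growth `∫∫_{Q_a(0)} |p|^{3/2} ≤ K a^m`, `m < 3` — in the crux class `m = 2 − 2ρ` — kills functions of time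
(`PressureSlaving.ae_eq_zero_of_ae_const_of_cylinderGrowth`).  Hence:

* `PressureSlaving.pressure_ae_unique` — **UNIQUENESS**: two pressures of one velocity, both with the `D`-type growth, agree a.e. on the slab.  In particular the
  class pressure is determined a.e. by the velocity: the pressure is a FUNCTIONAL of `u` in Seregin's class.
* `PressureSlaving.pressure_ae_eq_stPull_of_velocity_fixed` — **SYMMETRY INHERITANCE**: if a slab-preserving Euler rescaling `(s, y) ↦ (β s, x₀ + γ y)` with
  amplitude `α` (`β = α γ > 0`; tree `stPull`, `IsDistributionalNSSolutionOn.stRescale`) fixes the velocity on the slab, `α u(β s, x₀ + γ y) = u(s, y)`, then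
  it fixes the pressure a.e.: `p(s, y) = α² p(β s, x₀ + γ y)` for a.e. `(s, y)`.  Instances: the self-similar group `(β^{1−g}, β, β^{g})`
  (`PressureSlaving.ae_eq_rescaledPressure`), the DSS generator (ns-ezl-w1 `DSSPressureSlaving.ae_eq_dssPressure`), space translations / periods
  (`α = β = γ = 1`: the pressure of a space-periodic velocity is space-periodic a.e.), pure dilations.

WHAT THIS IS NOT: not NS regularity, not the crux E — a structural lemma on the crux CLASS 19832 (MODEL lattice) for the census; `--supports` stmt-19832.
[folklore; RusinSverak2011 §2 p. 4; CaffarelliKohnNirenberg1982 §2; AlbrittonBarker2019 §1]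
-/

noncomputable section

-- flat `Theorems/<Route><Decl>…` files of one crux share the namespace of the crux (tree convention: `Summit.<S>.<S>.…`)
set_option linter.dupNamespace false

open MeasureTheory Set Filter Topology Metric Function TopologicalSpace
open scoped ENNReal NNReal

namespace Summit.NavierStokesRegularity.NavierStokesRegularity.Theorems.PowerGaugeEulerLiouville

open Literature.Analysis Literature.Analysis.FunctionSpaces Literature.Analysis.FluidPDE

namespace PressureSlaving

/-! ### Uniqueness of the pressure a.e. -/

/-- **IN THE CLASS THE PRESSURE IS DETERMINED BY THE VELOCITY (a.e.).**  If `(u, p)` and `(u, q)` are distributional Euler solutions (no force) on the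
slab `(−∞,0) × ℝ³` with the same velocity, and both pressures have the `D`-type growth `∫∫_{Q_a(0)} |·|^{3/2} ≤ K a^m` for `a ≥ a₀` with `K < ∞` and
`m < 3`, then `p = q` a.e. on the slab. [folklore; RusinSverak2011 §2 p. 4; AlbrittonBarker2019 §1] -/
theorem pressure_ae_unique
    {u : ℝ → EuclideanSpace ℝ (Fin 3) → EuclideanSpace ℝ (Fin 3)} {p q : ℝ → EuclideanSpace ℝ (Fin 3) → ℝ}
    (hp : IsDistributionalNSSolutionOn (slab (EuclideanSpace ℝ (Fin 3)) (Iio 0) isOpen_Iio) 0 0 u p)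
    (hq : IsDistributionalNSSolutionOn (slab (EuclideanSpace ℝ (Fin 3)) (Iio 0) isOpen_Iio) 0 0 u q)
    {K : ℝ≥0∞} (hK : K ≠ ⊤) {m a₀ : ℝ} (hm : m < 3)
    (hDp : ∀ a : ℝ, a₀ ≤ a →
      ∫⁻ z in parabolicCylinder a (0 : ℝ × EuclideanSpace ℝ (Fin 3)), ‖p z.1 z.2‖ₑ ^ (3 / 2 : ℝ) ≤ K * ENNReal.ofReal (a ^ m))
    (hDq : ∀ a : ℝ, a₀ ≤ a →
      ∫⁻ z in parabolicCylinder a (0 : ℝ × EuclideanSpace ℝ (Fin 3)), ‖q z.1 z.2‖ₑ ^ (3 / 2 : ℝ) ≤ K * ENNReal.ofReal (a ^ m)) :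
    ∀ᵐ z ∂(volume.restrict (Iio (0 : ℝ) ×ˢ (univ : Set (EuclideanSpace ℝ (Fin 3))))), p z.1 z.2 = q z.1 z.2 := by
  set F : ℝ → EuclideanSpace ℝ (Fin 3) → ℝ := fun t x => p t x - q t x with hFdef
  suffices hF0 : ∀ᵐ z ∂(volume.restrict (Iio (0 : ℝ) ×ˢ (univ : Set (EuclideanSpace ℝ (Fin 3))))), F z.1 z.2 = 0 by
    filter_upwards [hF0] with z hz
    exact sub_eq_zero.1 hz
  have hpl : LocallyIntegrableOn (uncurry p) (Iio (0 : ℝ) ×ˢ (univ : Set (EuclideanSpace ℝ (Fin 3)))) volume := by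
    have h := hp.2.2.1; rwa [coe_slab] at h
  have hql : LocallyIntegrableOn (uncurry q) (Iio (0 : ℝ) ×ˢ (univ : Set (EuclideanSpace ℝ (Fin 3)))) volume := by
    have h := hq.2.2.1; rwa [coe_slab] at h
  have hFl : LocallyIntegrableOn (uncurry F) (Iio (0 : ℝ) ×ˢ (univ : Set (EuclideanSpace ℝ (Fin 3)))) volume := hpl.sub hql
  -- `F` is a function of time a.e.
  have hconstT : ∀ T₁ : ℝ, ∀ᵐ t ∂(volume.restrict (Ioo T₁ 0)), ∃ κ : ℝ,
      ∀ᵐ x ∂(volume : Measure (EuclideanSpace ℝ (Fin 3))), F t x = κ := by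
    intro T₁
    have hle : slab (EuclideanSpace ℝ (Fin 3)) (Ioo T₁ 0) isOpen_Ioo ≤
        slab (EuclideanSpace ℝ (Fin 3)) (Iio 0) isOpen_Iio := slab_mono Ioo_subset_Iio_self
    refine ae_exists_const_of_forall_integral_mul_divergence_eq_zero (hFl.mono_set (prod_mono Ioo_subset_Iio_self le_rfl)) ?_
    intro ψ hψ
    have h := setIntegral_sub_mul_divergence_eq_zero (hp.of_le hle) (hq.of_le hle) hψ
    rwa [coe_slab] at h
  have hconst : ∀ᵐ t ∂(volume.restrict (Iio (0 : ℝ))), ∃ κ : ℝ,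
      ∀ᵐ x ∂(volume : Measure (EuclideanSpace ℝ (Fin 3))), F t x = κ := by
    have hcover : Iio (0 : ℝ) ⊆ ⋃ n : ℕ, Ioo (-((n : ℝ) + 1)) 0 := by
      intro t ht
      obtain ⟨n, hn⟩ := exists_nat_gt (-t)
      exact mem_iUnion.2 ⟨n, ⟨by linarith, ht⟩⟩
    exact ae_restrict_of_ae_restrict_of_subset hcover ((ae_restrict_iUnion_iff _ _).2 fun n => hconstT _)
  -- the growth of `F`
  have hsubQ : ∀ a : ℝ, parabolicCylinder a (0 : ℝ × EuclideanSpace ℝ (Fin 3)) ⊆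
      Iio (0 : ℝ) ×ˢ (univ : Set (EuclideanSpace ℝ (Fin 3))) := by
    rintro a ⟨t, x⟩ hz
    rw [mem_parabolicCylinder] at hz
    exact mem_prod.2 ⟨by simpa using hz.1.2, mem_univ _⟩
  have hgrowth : ∀ a : ℝ, a₀ ≤ a →
      ∫⁻ z in parabolicCylinder a (0 : ℝ × EuclideanSpace ℝ (Fin 3)), ‖F z.1 z.2‖ₑ ^ (3 / 2 : ℝ) ≤
        (2 ^ ((3 / 2 : ℝ) - 1) * (K + K)) * ENNReal.ofReal (a ^ m) := by
    intro a ha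
    have hpmQ : AEMeasurable (fun z : ℝ × EuclideanSpace ℝ (Fin 3) => ‖p z.1 z.2‖ₑ ^ (3 / 2 : ℝ))
        (volume.restrict (parabolicCylinder a (0 : ℝ × EuclideanSpace ℝ (Fin 3)))) :=
      ((hpl.aestronglyMeasurable.mono_measure (Measure.restrict_mono (hsubQ a) le_rfl)).aemeasurable.enorm.pow_const _)
    calc ∫⁻ z in parabolicCylinder a (0 : ℝ × EuclideanSpace ℝ (Fin 3)), ‖F z.1 z.2‖ₑ ^ (3 / 2 : ℝ)
        ≤ ∫⁻ z in parabolicCylinder a (0 : ℝ × EuclideanSpace ℝ (Fin 3)),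
            2 ^ ((3 / 2 : ℝ) - 1) * (‖p z.1 z.2‖ₑ ^ (3 / 2 : ℝ) + ‖q z.1 z.2‖ₑ ^ (3 / 2 : ℝ)) := by
          refine lintegral_mono fun z => ?_
          calc ‖F z.1 z.2‖ₑ ^ (3 / 2 : ℝ) ≤ (‖p z.1 z.2‖ₑ + ‖q z.1 z.2‖ₑ) ^ (3 / 2 : ℝ) := by
                gcongr
                exact enorm_sub_le
            _ ≤ 2 ^ ((3 / 2 : ℝ) - 1) * (‖p z.1 z.2‖ₑ ^ (3 / 2 : ℝ) + ‖q z.1 z.2‖ₑ ^ (3 / 2 : ℝ)) :=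
                ENNReal.rpow_add_le_mul_rpow_add_rpow _ _ (by norm_num)
      _ = 2 ^ ((3 / 2 : ℝ) - 1) * ((∫⁻ z in parabolicCylinder a (0 : ℝ × EuclideanSpace ℝ (Fin 3)), ‖p z.1 z.2‖ₑ ^ (3 / 2 : ℝ)) +
            ∫⁻ z in parabolicCylinder a (0 : ℝ × EuclideanSpace ℝ (Fin 3)), ‖q z.1 z.2‖ₑ ^ (3 / 2 : ℝ)) := by
          rw [lintegral_const_mul' _ _ (ENNReal.rpow_ne_top_of_nonneg (by norm_num) ENNReal.ofNat_ne_top),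
            lintegral_add_left' hpmQ]
      _ ≤ 2 ^ ((3 / 2 : ℝ) - 1) * (K * ENNReal.ofReal (a ^ m) + K * ENNReal.ofReal (a ^ m)) := by
          gcongr
          · exact hDp a ha
          · exact hDq a ha
      _ = (2 ^ ((3 / 2 : ℝ) - 1) * (K + K)) * ENNReal.ofReal (a ^ m) := by ring
  have hKtot : 2 ^ ((3 / 2 : ℝ) - 1) * (K + K) ≠ ⊤ :=
    ENNReal.mul_ne_top (ENNReal.rpow_ne_top_of_nonneg (by norm_num) ENNReal.ofNat_ne_top) (ENNReal.add_ne_top.2 ⟨hK, hK⟩)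
  exact ae_eq_zero_of_ae_const_of_cylinderGrowth (r := 3 / 2) (by norm_num) hFl.aestronglyMeasurable hconst hKtot hm hgrowth

/-! ### Inheritance of slab-preserving Euler symmetries -/

/-- `Q_a(0) ⊆ Φ⁻¹ Q_{L a}(0)` for the rescaling `Φ(s, y) = (β s, x₀ + γ y)` (`β, γ > 0`, `a ≥ 1`), `L = β + γ + ‖x₀‖ + 1`. [folklore] -/
theorem parabolicCylinder_subset_preimage_translate {β γ a : ℝ} (hβ : 0 < β) (hγ : 0 < γ) (x₀ : EuclideanSpace ℝ (Fin 3)) (ha : 1 ≤ a) :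
    parabolicCylinder a (0 : ℝ × EuclideanSpace ℝ (Fin 3)) ⊆
      stAffine β γ 0 x₀ ⁻¹' parabolicCylinder ((β + γ + ‖x₀‖ + 1) * a) (0 : ℝ × EuclideanSpace ℝ (Fin 3)) := by
  rintro ⟨t, x⟩ hz
  rw [mem_parabolicCylinder] at hz
  simp only [Prod.fst_zero, Prod.snd_zero, zero_sub, dist_zero_right] at hz
  rw [mem_preimage, mem_parabolicCylinder]
  simp only [stAffine_fst, stAffine_snd, Prod.fst_zero, Prod.snd_zero, zero_sub, zero_add, dist_zero_right]
  obtain ⟨⟨ht1, ht2⟩, hx⟩ := hz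
  have hx0 : 0 ≤ ‖x₀‖ := norm_nonneg _
  refine ⟨⟨?_, mul_neg_of_pos_of_neg hβ ht2⟩, ?_⟩
  · have h1 : -(β * a ^ 2) < β * t := by nlinarith
    have h2 : β * a ^ 2 ≤ ((β + γ + ‖x₀‖ + 1) * a) ^ 2 := by
      nlinarith [sq_nonneg a, sq_nonneg (β + γ + ‖x₀‖), hβ.le, hγ.le, hx0]
    linarith
  · calc ‖x₀ + γ • x‖ ≤ ‖x₀‖ + ‖γ • x‖ := norm_add_le _ _
      _ = ‖x₀‖ + γ * ‖x‖ := by rw [norm_smul, Real.norm_eq_abs, abs_of_pos hγ]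
      _ < ‖x₀‖ + γ * a := by nlinarith
      _ ≤ (β + γ + ‖x₀‖ + 1) * a := by nlinarith

/-- **THE PRESSURE INHERITS EVERY SLAB-PRESERVING EULER SYMMETRY OF THE VELOCITY (a.e.).**  Let `(u, p)` be a distributional Euler solution (no force) on
`(−∞,0) × ℝ³` with the `D`-type growth `∫∫_{Q_a(0)}|p|^{3/2} ≤ K a^m` (`a ≥ a₀`, `K < ∞`, `m < 3`), and let `α, γ > 0`, `β = α γ`, `x₀ ∈ ℝ³`.  If the Euler
rescaling `w = α • stPull β γ 0 x₀ u` (i.e. `w(s, y) = α u(β s, x₀ + γ y)`) coincides with `u` on the slab, then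
`p(s, y) = α² p(β s, x₀ + γ y)` for a.e. `(s, y)` in the slab.  (Covariance `IsDistributionalNSSolutionOn.stRescale` makes `(u, α² • stPull β γ 0 x₀ p)` a second
pressure of the same velocity with the same type of growth; then `pressure_ae_unique`.) [folklore; CaffarelliKohnNirenberg1982 §2; RusinSverak2011 §2 p. 4] -/
theorem pressure_ae_eq_stPull_of_velocity_fixed {α β γ : ℝ} (hα : 0 < α) (hγ : 0 < γ) (hβ : β = α * γ) (x₀ : EuclideanSpace ℝ (Fin 3))
    {u : ℝ → EuclideanSpace ℝ (Fin 3) → EuclideanSpace ℝ (Fin 3)} {p : ℝ → EuclideanSpace ℝ (Fin 3) → ℝ}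
    (hdist : IsDistributionalNSSolutionOn (slab (EuclideanSpace ℝ (Fin 3)) (Iio 0) isOpen_Iio) 0 0 u p)
    {K : ℝ≥0∞} (hK : K ≠ ⊤) {m a₀ : ℝ} (hm : m < 3)
    (hD : ∀ a : ℝ, a₀ ≤ a →
      ∫⁻ z in parabolicCylinder a (0 : ℝ × EuclideanSpace ℝ (Fin 3)), ‖p z.1 z.2‖ₑ ^ (3 / 2 : ℝ) ≤ K * ENNReal.ofReal (a ^ m))
    (hfix : ∀ z : ℝ × EuclideanSpace ℝ (Fin 3), z.1 < 0 → (α • stPull β γ 0 x₀ u) z.1 z.2 = u z.1 z.2) :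
    ∀ᵐ z ∂(volume.restrict (Iio (0 : ℝ) ×ˢ (univ : Set (EuclideanSpace ℝ (Fin 3))))),
      p z.1 z.2 = α ^ 2 * p (β * z.1) (x₀ + γ • z.2) := by
  have hβ0 : 0 < β := by rw [hβ]; positivity
  -- the slab is invariant
  have hslab : stPreimage β γ 0 x₀ (slab (EuclideanSpace ℝ (Fin 3)) (Iio 0) isOpen_Iio) =
      slab (EuclideanSpace ℝ (Fin 3)) (Iio 0) isOpen_Iio := by
    apply TopologicalSpace.Opens.ext
    ext z
    simp only [coe_stPreimage, coe_slab, mem_preimage, mem_prod, mem_univ, and_true, mem_Iio, stAffine_fst, zero_add]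
    constructor
    · intro h
      by_contra h'
      exact absurd h (not_lt.2 (mul_nonneg hβ0.le (not_lt.1 h')))
    · intro h
      exact mul_neg_of_pos_of_neg hβ0 h
  -- the rescaled pair, same velocity
  set q : ℝ → EuclideanSpace ℝ (Fin 3) → ℝ := α ^ 2 • stPull β γ 0 x₀ p with hqdef
  have hq : IsDistributionalNSSolutionOn (slab (EuclideanSpace ℝ (Fin 3)) (Iio 0) isOpen_Iio) 0 0 u q := by
    have h := hdist.stRescale hα hγ hβ 0 x₀
    rw [hslab, mul_zero, zero_div] at h
    have h0 : (α ^ 2 * γ) • stPull β γ 0 x₀ (0 : ℝ → EuclideanSpace ℝ (Fin 3) → EuclideanSpace ℝ (Fin 3)) = 0 := by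
      funext s y
      rw [smul_stPull_apply]
      simp
    rw [h0] at h
    refine h.congr_ae ?_ (ae_of_all _ fun _ => rfl)
    rw [coe_slab]
    filter_upwards [ae_restrict_mem (measurableSet_Iio.prod MeasurableSet.univ)] with z hz
    exact hfix z (mem_prod.1 hz).1
  -- the growth of `q` by change of variables
  set L : ℝ := β + γ + ‖x₀‖ + 1 with hL
  have hL1 : 1 ≤ L := by rw [hL]; linarith [hβ0.le, hγ.le, norm_nonneg x₀]
  set Kβ : ℝ≥0∞ := ‖α ^ 2‖ₑ ^ (3 / 2 : ℝ) * ENNReal.ofReal (β * γ ^ Module.finrank ℝ (EuclideanSpace ℝ (Fin 3)))⁻¹ with hKβ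
  have hKβtop : Kβ ≠ ⊤ :=
    ENNReal.mul_ne_top (ENNReal.rpow_ne_top_of_nonneg (by norm_num) enorm_ne_top) ENNReal.ofReal_ne_top
  have hDq : ∀ a : ℝ, max a₀ 1 ≤ a →
      ∫⁻ z in parabolicCylinder a (0 : ℝ × EuclideanSpace ℝ (Fin 3)), ‖q z.1 z.2‖ₑ ^ (3 / 2 : ℝ) ≤
        (Kβ * K * ENNReal.ofReal (L ^ m)) * ENNReal.ofReal (a ^ m) := by
    intro a ha
    have ha₀ : a₀ ≤ a := (le_max_left _ _).trans ha
    have ha1 : 1 ≤ a := (le_max_right _ _).trans ha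
    have ha0 : 0 < a := one_pos.trans_le ha1
    calc ∫⁻ z in parabolicCylinder a (0 : ℝ × EuclideanSpace ℝ (Fin 3)), ‖q z.1 z.2‖ₑ ^ (3 / 2 : ℝ)
        ≤ ∫⁻ z in stAffine β γ 0 x₀ ⁻¹' parabolicCylinder (L * a) (0 : ℝ × EuclideanSpace ℝ (Fin 3)), ‖q z.1 z.2‖ₑ ^ (3 / 2 : ℝ) :=
          lintegral_mono_set (parabolicCylinder_subset_preimage_translate hβ0 hγ x₀ ha1)
      _ = Kβ * ∫⁻ z in parabolicCylinder (L * a) (0 : ℝ × EuclideanSpace ℝ (Fin 3)), ‖p z.1 z.2‖ₑ ^ (3 / 2 : ℝ) := by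
          rw [hqdef, setLIntegral_enorm_rpow_stRescale hβ0 hγ 0 x₀ _ p _ (by norm_num), hKβ]
      _ ≤ Kβ * (K * ENNReal.ofReal ((L * a) ^ m)) := by
          gcongr
          exact hD _ (ha₀.trans (by nlinarith))
      _ = (Kβ * K * ENNReal.ofReal (L ^ m)) * ENNReal.ofReal (a ^ m) := by
          rw [Real.mul_rpow (by linarith) ha0.le, ENNReal.ofReal_mul (Real.rpow_nonneg (by linarith) _)]
          ring
  -- a common constant for both growths on `a ≥ max a₀ 1`
  have hDp' : ∀ a : ℝ, max a₀ 1 ≤ a →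
      ∫⁻ z in parabolicCylinder a (0 : ℝ × EuclideanSpace ℝ (Fin 3)), ‖p z.1 z.2‖ₑ ^ (3 / 2 : ℝ) ≤
        (K + Kβ * K * ENNReal.ofReal (L ^ m)) * ENNReal.ofReal (a ^ m) := fun a ha =>
    (hD a ((le_max_left _ _).trans ha)).trans (by gcongr; exact le_self_add)
  have hDq' : ∀ a : ℝ, max a₀ 1 ≤ a →
      ∫⁻ z in parabolicCylinder a (0 : ℝ × EuclideanSpace ℝ (Fin 3)), ‖q z.1 z.2‖ₑ ^ (3 / 2 : ℝ) ≤
        (K + Kβ * K * ENNReal.ofReal (L ^ m)) * ENNReal.ofReal (a ^ m) := fun a ha =>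
    (hDq a ha).trans (by gcongr; exact le_add_self)
  have hKtot : K + Kβ * K * ENNReal.ofReal (L ^ m) ≠ ⊤ :=
    ENNReal.add_ne_top.2 ⟨hK, ENNReal.mul_ne_top (ENNReal.mul_ne_top hKβtop hK) ENNReal.ofReal_ne_top⟩
  have h := pressure_ae_unique hdist hq hKtot hm hDp' hDq'
  filter_upwards [h] with z hz
  rw [hz, hqdef, smul_stPull_apply, zero_add, smul_eq_mul]

end PressureSlaving

end Summit.NavierStokesRegularity.NavierStokesRegularity.Theorems.PowerGaugeEulerLiouville

end
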